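import Summits.ABC.IUTFork.Cor312NaiveProvThm311
import HarnessLib

/-!
# The PINNED naive model over ANY index skeleton, I: base-point coordinates, generic splitting monoids,
# the theta value carried by ONE tensor factor

Record-only file (D-0012) of the abc-iut cell (D-0067 adjudication, ADJUDICATION-SPEC §2 (G-PINNED)/(G3″);
support piece «G-NV-PROV-PINNED» = PR-2 × PROVENANCE, seat abc-iut-w4-d026 gen 3); TAKES NO SIDE on
[IUTchIII] Cor. 3.12.  The (G3″) countermodel of record (abc-iut-w4-d101's `PinnedWitness.pinned_countermodel`,
`Cor312PinnedCountermodel` p419720: typed Thm. 3.11 ∧ BridgeHyps ∧ AbsLogQPos ∧ the THREE PINS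
`PinnedRegions3` ∧ ¬GapA″ ∧ ¬GapA3 ∧ ¬GapH3 ∧ ¬PilotKummerIndRelated) lives over c312-7's one-place `toyIndex`
(`l⋆ = 2`; by its own honest scope "NOT a model of the intended initial Θ-data").  This seat's gen 2 lifted the
UNPINNED contentful witness to every index skeleton and to the provenance level of every initial Θ-datum
(`Cor312NaiveProv{Shells,Thm311,Setting,Witness}`, p418126/p418511/p418887/p419174).  This file starts the same lift
for the PINNED round.  Part I of four.

WHAT IS NEW HERE (all over an ARBITRARY `T : Thm311.ThetaIndex`, on gen 2's sign shells `signShells T`):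
* §A1 `ActsBySignsAll` — every element of the group generated by (Ind1), (Ind2) multiplies the packet
  coordinate `coordAt j v_ℚ w` AT EVERY BASE POINT `w | v_ℚ` by some `ε`, `|ε| = 1` (gen 2 proved this at the
  one chosen point `fibrePt v_ℚ` only; the pinned region operator of Part IV reads each bad place's datum at
  ITS OWN summand `w = v`, so the general base point is needed for the (hρ)-equivariance of the pins);
  `bcoord v j ψ` := the coordinate, at the summand `v`, of the `j`-component of a splitting-monoid element at `v`.
* §A2 `PsiOf θ v` — the sign-saturated splitting monoid `{(±θ_{v,j})_{j ∈ 𝔽_l^⋆}}` of an ARBITRARY family of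
  theta vectors `θ`; the Kummer twist maps it onto itself (`image_PsiOf_twist`), it is zero-free when the
  vectors are nonzero, and sits in the sub-packets when the vectors do.
* §A3 `thetaVec1 p v j` — the theta vector whose `α = j` tensor factor (c312-1's `selfIndex j`, [IUTchIII]
  Prop. 3.1 (ii)/3.2: the sub-packet `log(^{S^±_{j+1},j}𝒟⊢_v)`) is the theta VALUE `q^{j²}` placed on the
  summand `v`, the other `j` factors being the all-ones vector: it lies in the sub-packet at `v`, is nonzero,
  and its coordinate at `v` is EXACTLY `q^{j²}` (`bcoord_thetaVec1`) — so a region operator reading the datum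
  honestly returns the ideal `q^{j²}·𝒪` (Part IV).  (gen 2's `thetaVec` carries `q^{j²}` in EVERY factor,
  coordinate `q^{(j+1)j²}`: immaterial while the glue was free, not readable honestly under the pins.)
HONEST SCOPE: a model of the typed signatures (regions will be cylinders along one packet coordinate), not of
the intended objects; no judgement on print; no `Prop` fact; standard axioms. [claim: Mochizuki2012, status: disputed]
[cite: ScholzeStix2018, §2.2 pp. 9–10]
-/

noncomputable section

namespace Summit.ABC

namespace IUTFork

namespace Cor312Vol

namespace NaiveProv

open Thm311 Cor312 Cor312.IdentifiedNonVacuity Literature.IUT.LogThetaLattice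

variable {T : ThetaIndex}

/-! ## A1. The (Ind1),(Ind2)-group acts by signs on the packet coordinate at every base point -/

/-- A packet-automorphism family ACTS BY SIGNS AT EVERY BASE POINT if on every packet `(j, v_ℚ)` and for
every `w | v_ℚ` it multiplies the coordinate `coordAt j v_ℚ w` by some `ε` with `|ε| = 1` (gen 2's
`ActsBySigns` is the case `w = fibrePt v_ℚ`; a local bookkeeping predicate, not a fact). [folklore] -/
structure ActsBySignsAll (Φ : (signShells T).PacketAut) : Prop where
  /-- on every packet and at every base point `Φ` multiplies the coordinate by a sign -/
  sign : ∀ (j : T.Label) (vQ : T.VQ) (w : T.Fibre vQ), ∃ ε : ℚ, |ε| = 1 ∧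
    ∀ x : (signShells T).Packet j vQ, coordAt j vQ w (Φ j vQ x) = ε * coordAt j vQ w x

/-- A summand-wise sign automorphism of the 1-packet multiplies the `w`-coordinate by the sign it carries
at `w`. [folklore] -/
theorem proj_summandwise_at (vQ : T.VQ) (w : T.Fibre vQ)
    (g : ∀ v : T.Fibre vQ, (signShells T).carrier v.1 ≃ₗ[ℚ] (signShells T).carrier v.1)
    (hg : ∀ v, g v ∈ signs) :
    ∃ s : ℚ, |s| = 1 ∧ ∀ y : (signShells T).Packet1 vQ,
      ((signShells T).summandwise vQ g y) w = s * y w := by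
  obtain ⟨s, hs, hgs⟩ := exists_eq_mul_of_mem_signs (hg w)
  exact ⟨s, hs, fun y => hgs _⟩

/-- A factor-wise automorphism whose factors scale the `w`-coordinate by `s_i` scales the packet coordinate
at `w` by `∏ s_i`. [folklore] -/
theorem coordAt_factorwise (j : T.Label) (vQ : T.VQ) (w : T.Fibre vQ)
    (e : T.Caps j → ((signShells T).Packet1 vQ ≃ₗ[ℚ] (signShells T).Packet1 vQ)) (s : T.Caps j → ℚ)
    (he : ∀ i (y : (signShells T).Packet1 vQ), (e i y) w = s i * y w)
    (x : (signShells T).Packet j vQ) :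
    coordAt j vQ w ((signShells T).factorwise j vQ e x) = (∏ i, s i) * coordAt j vQ w x := by
  have h : (coordAt j vQ w).comp ((signShells T).factorwise j vQ e).toLinearMap =
      (∏ i, s i) • coordAt j vQ w := by
    apply PiTensorProduct.ext
    ext y
    simp only [LinearMap.compMultilinearMap_apply]
    show coordAt j vQ w ((signShells T).factorwise j vQ e (PiTensorProduct.tprod ℚ y)) =
      (∏ i, s i) • coordAt j vQ w (PiTensorProduct.tprod ℚ y)
    unfold LogShells.factorwise
    erw [PiTensorProduct.congr_tprod]
    rw [coordAt_tprod, coordAt_tprod, smul_eq_mul, ← Finset.prod_mul_distrib]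
    exact Finset.prod_congr rfl fun i _ => he i (y i)
  exact congrArg (fun f : (signShells T).Packet j vQ →ₗ[ℚ] ℚ => f x) h

/-- A permutation of the tensor factors does not change the packet coordinate at any base point. [folklore] -/
theorem coordAt_permute (j : T.Label) (vQ : T.VQ) (w : T.Fibre vQ) (σ : Equiv.Perm (T.Caps j))
    (x : (signShells T).Packet j vQ) :
    coordAt j vQ w ((signShells T).permute j vQ σ x) = coordAt j vQ w x := by
  have h : (coordAt j vQ w).comp ((signShells T).permute j vQ σ).toLinearMap = coordAt j vQ w := by
    apply PiTensorProduct.ext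
    ext y
    simp only [LinearMap.compMultilinearMap_apply]
    show coordAt j vQ w ((signShells T).permute j vQ σ (PiTensorProduct.tprod ℚ y)) =
      coordAt j vQ w (PiTensorProduct.tprod ℚ y)
    unfold LogShells.permute
    erw [PiTensorProduct.reindex_tprod]
    rw [coordAt_tprod, coordAt_tprod]
    exact Equiv.prod_comp σ.symm fun i => (y i w : ℚ)
  exact congrArg (fun f : (signShells T).Packet j vQ →ₗ[ℚ] ℚ => f x) h

/-- Every (Ind2)-family acts by signs at every base point. [folklore] -/
theorem actsBySignsAll_of_mem_Ind2Family {Φ : (signShells T).PacketAut}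
    (h : Φ ∈ (signShells T).Ind2Family) : ActsBySignsAll Φ := by
  refine ⟨fun j vQ w => ?_⟩
  obtain ⟨g, hg, hΦ⟩ := h j vQ
  have hs : ∀ i, ∃ s : ℚ, |s| = 1 ∧ ∀ y : (signShells T).Packet1 vQ,
      ((signShells T).summandwise vQ (g i) y) w = s * y w :=
    fun i => proj_summandwise_at vQ w (g i) (hg i)
  choose s hs1 hs2 using hs
  refine ⟨∏ i, s i, abs_prod_eq_one hs1, fun x => ?_⟩
  rw [hΦ]
  exact coordAt_factorwise j vQ w _ s hs2 x

/-- Every (Ind1)-family acts by signs at every base point. [folklore] -/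
theorem actsBySignsAll_of_mem_Ind1Family {Φ : (signShells T).PacketAut}
    (h : Φ ∈ (signShells T).Ind1Family) : ActsBySignsAll Φ := by
  refine ⟨fun j vQ w => ?_⟩
  obtain ⟨σ, hh, hmem, hΦ⟩ := h j
  have hs : ∀ i, ∃ s : ℚ, |s| = 1 ∧ ∀ y : (signShells T).Packet1 vQ,
      ((signShells T).summandwise vQ (fun v => hh i v.1) y) w = s * y w :=
    fun i => proj_summandwise_at vQ w (fun v => hh i v.1) fun v => hmem i v.1
  choose s hs1 hs2 using hs
  refine ⟨∏ i, s i, abs_prod_eq_one hs1, fun x => ?_⟩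
  have hΦ' : Φ j vQ = ((signShells T).permute j vQ σ).trans
      ((signShells T).factorwise j vQ fun i => (signShells T).summandwise vQ fun v => hh i v.1) := hΦ vQ
  rw [hΦ', LinearEquiv.trans_apply, coordAt_factorwise j vQ w _ s hs2, coordAt_permute]

/-- The identity family acts by signs at every base point. [folklore] -/
theorem actsBySignsAll_one : ActsBySignsAll (1 : (signShells T).PacketAut) :=
  ⟨fun j vQ w => ⟨1, abs_one, fun x => by rw [one_mul]; rfl⟩⟩

/-- Acting by signs at every base point is closed under composition. [folklore] -/
theorem ActsBySignsAll.mul {Φ Ψ : (signShells T).PacketAut} (hΦ : ActsBySignsAll Φ) (hΨ : ActsBySignsAll Ψ) :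
    ActsBySignsAll (Φ * Ψ) := by
  refine ⟨fun j vQ w => ?_⟩
  obtain ⟨ε, hε, hΦε⟩ := hΦ.sign j vQ w
  obtain ⟨δ, hδ, hΨδ⟩ := hΨ.sign j vQ w
  refine ⟨ε * δ, by rw [abs_mul, hε, hδ, one_mul], fun x => ?_⟩
  show coordAt j vQ w (Φ j vQ (Ψ j vQ x)) = _
  rw [hΦε, hΨδ, mul_assoc]

/-- Acting by signs at every base point is closed under inverses. [folklore] -/
theorem ActsBySignsAll.inv {Φ : (signShells T).PacketAut} (hΦ : ActsBySignsAll Φ) : ActsBySignsAll Φ⁻¹ := by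
  refine ⟨fun j vQ w => ?_⟩
  obtain ⟨ε, hε, hΦε⟩ := hΦ.sign j vQ w
  have hε0 : ε ≠ 0 := by
    intro h; rw [h, abs_zero] at hε; exact zero_ne_one hε
  refine ⟨ε⁻¹, by rw [abs_inv, hε, inv_one], fun x => ?_⟩
  show coordAt j vQ w ((Φ j vQ).symm x) = _
  have h := hΦε ((Φ j vQ).symm x)
  rw [LinearEquiv.apply_symm_apply] at h
  rw [h, ← mul_assoc, inv_mul_cancel₀ hε0, one_mul]

/-- **Every element of the group generated by (Ind1), (Ind2) acts by signs at every base point** (closure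
induction). [folklore] -/
theorem actsBySignsAll_of_mem_closure {Φ : (signShells T).PacketAut}
    (h : Φ ∈ Subgroup.closure ((signShells T).Ind1Family ∪ (signShells T).Ind2Family)) :
    ActsBySignsAll Φ := by
  induction h using Subgroup.closure_induction with
  | mem Ψ hΨ =>
    rcases hΨ with h1 | h2
    · exact actsBySignsAll_of_mem_Ind1Family h1
    · exact actsBySignsAll_of_mem_Ind2Family h2
  | one => exact actsBySignsAll_one
  | mul Ψ Ψ' _ _ hΨ hΨ' => exact hΨ.mul hΨ'
  | inv Ψ _ hΨ => exact hΨ.inv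

/-- Acting by signs at every base point implies gen 2's `ActsBySigns` (the base point `fibrePt v_ℚ`).
[folklore] -/
theorem ActsBySignsAll.actsBySigns {Φ : (signShells T).PacketAut} (h : ActsBySignsAll Φ) : ActsBySigns Φ :=
  ⟨fun j vQ => h.sign j vQ (fibrePt vQ)⟩

/-- A sign `ε` (`|ε| = 1`) is `1` or `−1`; in particular `ε · ε = 1`. [folklore] -/
theorem mul_self_of_abs_eq_one {ε : ℚ} (hε : |ε| = 1) : ε * ε = 1 := by
  rcases (abs_eq (zero_le_one' ℚ)).1 hε with rfl | rfl <;> norm_num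

/-- **The BAD-PLACE COORDINATE** `bcoord v j ψ`: the packet coordinate, at the summand `v` ITSELF, of the
`j`-component (`j ∈ 𝔽_l^⋆`) of an element `ψ` of `∏_{j ∈ 𝔽_l^⋆} 𝓘^ℚ(^{S^±_{j+1}};𝒟⊢_{v_ℚ(v)})` — the functional
through which the pinned region operator of Part IV reads a bad place's splitting-monoid datum. [folklore] -/
def bcoord (v : T.V) (j : T.LabelStar) (ψ : (signShells T).StarPacket v) : ℚ :=
  coordAt j.1 (T.over v) (T.toFibre v) (ψ j)

/-- Transporting a splitting-monoid element by a family acting by signs at every base point multiplies its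
bad-place coordinate by a sign. [folklore] -/
theorem bcoord_starAut {Φ : (signShells T).PacketAut} (h : ActsBySignsAll Φ) (v : T.V) (j : T.LabelStar) :
    ∃ ε : ℚ, |ε| = 1 ∧ ∀ ψ : (signShells T).StarPacket v,
      bcoord v j ((signShells T).starAut Φ v ψ) = ε * bcoord v j ψ := by
  obtain ⟨ε, hε, hΦ⟩ := h.sign j.1 (T.over v) (T.toFibre v)
  exact ⟨ε, hε, fun ψ => hΦ (ψ j)⟩

/-! ## A2. Sign-saturated splitting monoids of an arbitrary family of theta vectors -/

/-- A FAMILY OF THETA VECTORS: one vector of the packet `𝓘^ℚ(^{S^±_{j+1}};𝒟⊢_{v_ℚ(v)})` per place `v` and label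
`j` (the Kummer image of the theta value at `(v, j)`; two instances: gen 2's `thetaVec`, and `thetaVec1`
below). [claim: Mochizuki2012, status: disputed] -/
abbrev ThetaFamily (T : ThetaIndex) : Type := ∀ (v : T.V) (j : T.Label), (signShells T).Packet j (T.over v)

variable (θ : ThetaFamily T)

/-- The SPLITTING MONOID at the bad place `v` of the family `θ`: the sign-translates `(±θ_{v,j})_{j ∈ 𝔽_l^⋆}`
([IUTchIII] Thm. 3.11 (i) (b); Prop. 3.5 (ii) (c): torsion-translates of the theta values; gen 2's `Psi`,
family-generic). [claim: Mochizuki2012, status: disputed] -/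
def PsiOf (v : T.V) : Set ((signShells T).StarPacket v) :=
  {f | ∀ j : T.LabelStar, f j = θ v j.1 ∨ f j = -θ v j.1}

/-- The tuple of theta vectors itself. [claim: Mochizuki2012, status: disputed] -/
def thetaTupleOf (v : T.V) : (signShells T).StarPacket v := fun j => θ v j.1

/-- The theta tuple lies in the splitting monoid (which is therefore NONEMPTY). [folklore] -/
theorem thetaTupleOf_mem_PsiOf (v : T.V) : thetaTupleOf θ v ∈ PsiOf θ v := fun _ => Or.inl rfl

/-- `0 ∉ Ψ_v` as soon as the theta vector at the label `1` is nonzero. [folklore] -/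
theorem zero_notMem_PsiOf (v : T.V) (hθ : θ v (labelOne (T := T)).1 ≠ 0) :
    (0 : (signShells T).StarPacket v) ∉ PsiOf θ v := by
  intro h
  rcases h labelOne with h1 | h1
  · exact hθ (h1.symm.trans rfl)
  · exact hθ (neg_eq_zero.1 (h1.symm.trans rfl))

/-- The splitting monoid sits in the product of the sub-packets as soon as the theta vectors do. [folklore] -/
theorem PsiOf_subPacket (v : T.V) (hθ : ∀ j : T.LabelStar, θ v j.1 ∈ (signShells T).SubPacket j.1 v)
    {f : (signShells T).StarPacket v} (hf : f ∈ PsiOf θ v) (j : T.LabelStar) :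
    f j ∈ (signShells T).SubPacket j.1 v := by
  rcases hf j with h | h
  · rw [h]; exact hθ j
  · rw [h]; exact Submodule.neg_mem _ (hθ j)

/-- **The Kummer twist `(−1)^m` maps `Ψ_v` onto itself** (sign-saturation; the twist is a scalar `±1` on every
packet — gen 2's `twist_eq_smul`). [folklore] -/
theorem image_PsiOf_twist (m : ℤ) (v : T.V) :
    (signShells T).starAut (twist m) v '' PsiOf θ v = PsiOf θ v := by
  have key : ∀ f : (signShells T).StarPacket v,
      (signShells T).starAut (twist m) v f ∈ PsiOf θ v ↔ f ∈ PsiOf θ v := by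
    intro f
    refine forall_congr' fun j => ?_
    obtain ⟨s, hs, hsm⟩ := twist_eq_smul m j.1 (T.over v)
    show (twist m j.1 _ (f j) = _ ∨ twist m j.1 _ (f j) = _) ↔ _
    rw [hsm]
    exact smul_eq_or_iff hs _ _
  apply Set.Subset.antisymm
  · rintro _ ⟨f, hf, rfl⟩; exact (key f).2 hf
  · intro f hf
    exact ⟨((signShells T).starAut (twist m) v).symm f, (key _).1 (by rwa [LinearEquiv.apply_symm_apply]),
      LinearEquiv.apply_symm_apply _ _⟩

/-- The bad-place coordinates of the elements of `Ψ_v` are `±` those of the theta vectors. [folklore] -/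
theorem bcoord_of_mem_PsiOf {v : T.V} {f : (signShells T).StarPacket v} (hf : f ∈ PsiOf θ v)
    (j : T.LabelStar) :
    bcoord v j f = bcoord v j (thetaTupleOf θ v) ∨ bcoord v j f = -bcoord v j (thetaTupleOf θ v) := by
  unfold bcoord thetaTupleOf
  rcases hf j with h | h
  · exact Or.inl (by rw [h])
  · exact Or.inr (by rw [h, map_neg])

variable (p : ℕ)

/-! ## A3. The theta value carried by the `α = j` tensor factor -/

open scoped Classical in
/-- **The ONE-FACTOR THETA VECTOR** at the place `v`, label `j`: the pure tensor whose `α = j` factor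
(c312-1's `selfIndex j` — [IUTchIII] Prop. 3.1 (ii)/3.2: the sub-packet `log(^{S^±_{j+1},j}𝒟⊢_v)` is "the tensor
product of the factors labeled by `β ∈ A∖{α}` with the direct summand with subscript `v` of the factor labeled
`α`") is the theta value `q^{j²}`, `q := p`, placed on the summand `v`, and whose other `j` factors are the
all-ones vector ([IUTchIII] Prop. 3.4 (ii)/3.5 (ii) (c): the value-group portion of the splitting monoid acts
on the tensor packet log-shell through that factor). [claim: Mochizuki2012, status: disputed] -/
def thetaVec1 (v : T.V) (j : T.Label) : (signShells T).Packet j (T.over v) :=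
  PiTensorProduct.tprod ℚ fun (i : T.Caps j) (w : T.Fibre (T.over v)) =>
    if i = T.selfIndex j then (if w = T.toFibre v then (p : ℚ) ^ ((j : ℕ) ^ 2) else 0) else 1

/-- The one-factor theta vector lies in the SUB-packet `𝓘^ℚ(^{S^±_{j+1},j};𝒟^⊢_v)` (its `α = j` factor is
supported on the summand `v`). [folklore] -/
theorem thetaVec1_mem_subPacket (v : T.V) (j : T.Label) : thetaVec1 p v j ∈ (signShells T).SubPacket j v := by
  classical
  refine Submodule.subset_span ⟨_, fun w hw => ?_, rfl⟩
  have hne : w ≠ T.toFibre v := fun h => hw (by rw [h]; rfl)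
  simp [hne]

/-- **The coordinate AT `v` of the one-factor theta vector is EXACTLY the theta value `q^{j²}`.** [folklore] -/
theorem coordAt_thetaVec1 (v : T.V) (j : T.Label) :
    coordAt j (T.over v) (T.toFibre v) (thetaVec1 p v j) = (p : ℚ) ^ ((j : ℕ) ^ 2) := by
  classical
  unfold thetaVec1
  rw [coordAt_tprod]
  rw [Finset.prod_eq_single (T.selfIndex j)]
  · simp
  · intro i _ hi
    simp [hi]
  · intro h
    exact absurd (Finset.mem_univ _) h

/-- The one-factor theta vector is NONZERO. [folklore] -/
theorem thetaVec1_ne_zero [hp : Fact p.Prime] (v : T.V) (j : T.Label) : thetaVec1 p v j ≠ 0 := by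
  intro h
  have h1 := congrArg (coordAt j (T.over v) (T.toFibre v)) h
  rw [coordAt_thetaVec1, map_zero] at h1
  exact pow_ne_zero _ (Nat.cast_ne_zero.mpr hp.out.ne_zero) h1

/-- The bad-place coordinate of the `j`-component of the one-factor theta tuple is `q^{j²}`. [folklore] -/
theorem bcoord_thetaVec1 (v : T.V) (j : T.LabelStar) :
    bcoord v j (thetaTupleOf (thetaVec1 p) v) = (p : ℚ) ^ ((j.1 : ℕ) ^ 2) :=
  coordAt_thetaVec1 p v j.1

/-- The bad-place coordinates of the elements of the one-factor splitting monoid `Ψ_v` are `±q^{j²}`. [folklore] -/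
theorem bcoord_of_mem_PsiOf_thetaVec1 {v : T.V} {f : (signShells T).StarPacket v}
    (hf : f ∈ PsiOf (thetaVec1 p) v) (j : T.LabelStar) :
    bcoord v j f = (p : ℚ) ^ ((j.1 : ℕ) ^ 2) ∨ bcoord v j f = -(p : ℚ) ^ ((j.1 : ℕ) ^ 2) := by
  rw [← bcoord_thetaVec1 p v j]
  exact bcoord_of_mem_PsiOf (thetaVec1 p) hf j

end NaiveProv

end Cor312Vol

end IUTFork

end Summit.ABC

end
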